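import Summits.CriticalPhenomena.PercolationContinuityZ3.Theorems.PercNearOneGluingNoHeavyLowerTailPairGainMonotone
import Literature.Probability.Percolation.KozmaNitzanPreFKG
import HarnessLib

/-!
# `NoHeavyLowerTail` (stmt-CriticalPhenomena-4575) — the MEDIAN BOUND for merging two glued groups

Support file (hull-port prover `prim-hp-1` gen 14; `--supports stmt-CriticalPhenomena-4575`).  No definitions, no named facts,
no sorries.  Memo: `run/shared/lean/prim/prim-hp-1/HULLPORT-COUPLING.md` §53.

Setting: a finite weighted graph `g`, two vertices `g₁ ≠ g₂` (in the application: the two hub groups of a two-hub block, already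
glued inside the split world `K/S¹∥S²`), an anchor `x` and a target `b`; `g' := g[s(g₁,g₂) ↦ 1]` is the merged (glued) world.
Write `hᵢ := μ_g(gᵢ ↔ b) − μ_g(x ↔ b)` (split-world advantages) and `h' := μ_{g'}(g₁ ↔ b) − μ_{g'}(x ↔ b)` (glued-world advantage
of the merged group).

* `pairGlue_anchor_le_add_posPart` — KN Lemma 5 for a pair WITH SLACK: `μ_{g'}(x ↔ b) ≤ μ_{g'}(g₁ ↔ b) + [μ_g(x ↔ b) − μ_g(g₂ ↔ b)]⁺`
  (and the same with `g₁` in the slack), from KN Lemma 3(ii) with `δ` (`KozmaNitzan2024_lemma3_ii`) on the decreasing event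
  `{x ↮ g₁, x ↮ g₂}`.
* `merge_adv_ge_median` — **the median bound** `h' ≥ max (min h₁ h₂) (min 0 (max h₁ h₂))` ( = median of `h₁, h₂, 0`):
  the weaker group transports its whole split-world advantage to the glued world (`pairGlue_gain_le`, lf-3), and the stronger
  group transports the negative part of its advantage (the slack form above).  This is the cellwise lower bound behind the
  "weak-group" functional of memo §53: `BQ(two hubs) ⟸ Σ_{σ≠∅} π(σ)·median(h_w(σ), 0, h_s(σ)) ≥ 0`.
-/

namespace Summit.CriticalPhenomena.PercolationContinuityZ3.Theorems

open MeasureTheory Set ProbabilityTheory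
open Literature.Probability.LatticeModels
open Literature.Probability.Percolation

noncomputable section
open Classical

namespace BlockQ9

variable {n : ℕ}

/-- **KN Lemma 5 for a glued pair, with slack.**  For `g₁ ≠ g₂` and `g' = g[s(g₁,g₂) ↦ 1]`:
`μ_{g'}(x ↔ b) ≤ μ_{g'}(g₁ ↔ b) + [μ_g(x ↔ b) − μ_g(g₂ ↔ b)]⁺`.  Proof: after the push-forward
(`real_openConn_pair_third`, `real_openConn_pair_eq`) the event `{x ↔ b}_{g'}` splits into `{x ↔ b, x ↮ g₁, x ↮ g₂}` and a part
inside `{x ↔ {g₁,g₂}} ∩ {{g₁,g₂} ↔ b}`; KN Lemma 3(ii) with `δ` moves the first onto `{g₂ ↔ b, x ↮ g₁, x ↮ g₂}`, which is disjoint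
from the second, and both lie in `{g₁ ↔ b} ∪ {g₂ ↔ b}`. [cite: KozmaNitzan2024, Lemma 3(ii) (pp. 6–7), Lemma 5 (p. 13)] -/
theorem pairGlue_anchor_le_add_posPart (g : Sym2 (Fin n) → unitInterval) {g₁ g₂ : Fin n} (h12 : g₁ ≠ g₂) (x b : Fin n) :
    (prodBernoulli (fun f : Sym2 (Fin n) => if f = s(g₁, g₂) then 1 else g f)).real (openConn x b) ≤
      (prodBernoulli (fun f : Sym2 (Fin n) => if f = s(g₁, g₂) then 1 else g f)).real (openConn g₁ b) +
        max 0 ((prodBernoulli g).real (openConn x b) - (prodBernoulli g).real (openConn g₂ b)) := by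
  have hmeas : ∀ X : Set (BondConfig (Fin n)), MeasurableSet X := fun _ => MeasurableSet.of_discrete
  set μ := prodBernoulli g with hμ
  set δ : ℝ := max 0 (μ.real (openConn x b) - μ.real (openConn g₂ b)) with hδ
  have hδ0 : 0 ≤ δ := le_max_left _ _
  rw [UpsetExchange.real_openConn_pair_third g h12 x b, (UpsetExchange.real_openConn_pair_eq g h12 b).1]
  -- the decreasing event `N = {x ↮ g₁, x ↮ g₂}`
  set B : Set (Fin n) := {g₁, g₂} with hB
  set N : Set (BondConfig (Fin n)) := {ω | ∀ u ∈ B, ¬ (openGraph ω).Reachable x u} with hN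
  -- KN Lemma 3(ii) with slack `δ`
  have hle : μ.real (openConn x b) ≤ μ.real (openConn g₂ b) + δ := by
    have := le_max_right 0 (μ.real (openConn x b) - μ.real (openConn g₂ b))
    linarith
  have L3 : μ.real (openConn x b ∩ N) ≤ μ.real (openConn g₂ b ∩ N) + δ := by
    have key := KozmaNitzan2024_lemma3_ii g x g₂ b hδ0 hle (KNPreFKG.isLowerSet_disconnFamily x B)
    rw [← KNPreFKG.setOf_forall_not_reachable_eq] at key
    exact key
  -- set algebra
  set W : Set (BondConfig (Fin n)) := (openConn x g₁ ∪ openConn x g₂) ∩ (openConn g₁ b ∪ openConn g₂ b) with hW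
  have hsub : openConn x b ∪ openConn x g₁ ∩ openConn g₂ b ∪ openConn x g₂ ∩ openConn g₁ b ⊆ (openConn x b ∩ N) ∪ W := by
    intro ω hω
    simp only [mem_union, mem_inter_iff] at hω
    by_cases h1 : ω ∈ (openConn x g₁ : Set (BondConfig (Fin n)))
    · right
      refine ⟨Or.inl h1, ?_⟩
      rcases hω with (hxb | ⟨_, h2b⟩) | ⟨_, h1b⟩
      · exact Or.inl ((show (openGraph ω).Reachable x g₁ from h1).symm.trans (show (openGraph ω).Reachable x b from hxb))
      · exact Or.inr h2b
      · exact Or.inl h1b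
    by_cases h2 : ω ∈ (openConn x g₂ : Set (BondConfig (Fin n)))
    · right
      refine ⟨Or.inr h2, ?_⟩
      rcases hω with (hxb | ⟨_, h2b⟩) | ⟨_, h1b⟩
      · exact Or.inr ((show (openGraph ω).Reachable x g₂ from h2).symm.trans (show (openGraph ω).Reachable x b from hxb))
      · exact Or.inr h2b
      · exact Or.inl h1b
    · left
      rcases hω with (hxb | ⟨hx1, _⟩) | ⟨hx2, _⟩
      · refine ⟨hxb, ?_⟩
        intro u hu
        simp only [hB, mem_insert_iff, mem_singleton_iff] at hu
        rcases hu with rfl | rfl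
        · exact h1
        · exact h2
      · exact absurd hx1 h1
      · exact absurd hx2 h2
  have hdisj : Disjoint (openConn g₂ b ∩ N) W := by
    rw [Set.disjoint_left]
    rintro ω ⟨_, hωN⟩ ⟨hxB, _⟩
    rcases hxB with h1 | h2
    · exact hωN g₁ (by simp [hB]) h1
    · exact hωN g₂ (by simp [hB]) h2
  have hin : (openConn g₂ b ∩ N) ∪ W ⊆ openConn g₁ b ∪ openConn g₂ b := by
    rintro ω (⟨h2b, _⟩ | ⟨_, hb⟩)
    · exact Or.inr h2b
    · exact hb
  calc μ.real (openConn x b ∪ openConn x g₁ ∩ openConn g₂ b ∪ openConn x g₂ ∩ openConn g₁ b)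
      ≤ μ.real ((openConn x b ∩ N) ∪ W) := measureReal_mono hsub
    _ ≤ μ.real (openConn x b ∩ N) + μ.real W := measureReal_union_le _ _
    _ ≤ μ.real (openConn g₂ b ∩ N) + δ + μ.real W := by linarith [L3]
    _ = μ.real ((openConn g₂ b ∩ N) ∪ W) + δ := by
        rw [measureReal_union hdisj (hmeas _)]; ring
    _ ≤ μ.real (openConn g₁ b ∪ openConn g₂ b) + δ := by linarith [measureReal_mono (μ := μ) hin]

/-- **The median bound for merging two groups.**  With `g' = g[s(g₁,g₂) ↦ 1]`, `hᵢ = μ_g(gᵢ ↔ b) − μ_g(x ↔ b)` and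
`h' = μ_{g'}(g₁ ↔ b) − μ_{g'}(x ↔ b)`:  `max (min h₁ h₂) (min 0 (max h₁ h₂)) ≤ h'` — the median of `h₁, h₂, 0`.  The weaker
group carries its full split-world advantage over `x` into the glued world (`UpsetExchange.pairGlue_gain_le`: the weaker endpoint
of a glued pair gains at least as much as any third vertex), the stronger one carries the negative part of its advantage
(`pairGlue_anchor_le_add_posPart`).  Used cellwise (groups = the attached port sets of the two hubs in the split world
`K/S¹∥S²`) it gives `BQ(two hubs) ⟸ Σ_{σ≠∅} π(σ) · median(h_w(σ), 0, h_s(σ)) ≥ 0` (memo §53).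
[cite: KozmaNitzan2024, Lemma 3 (pp. 6–7), Lemma 5 (p. 13)] -/
theorem merge_adv_ge_median (g : Sym2 (Fin n) → unitInterval) {g₁ g₂ : Fin n} (h12 : g₁ ≠ g₂) (x b : Fin n) :
    max (min ((prodBernoulli g).real (openConn g₁ b) - (prodBernoulli g).real (openConn x b))
          ((prodBernoulli g).real (openConn g₂ b) - (prodBernoulli g).real (openConn x b)))
        (min 0 (max ((prodBernoulli g).real (openConn g₁ b) - (prodBernoulli g).real (openConn x b))
          ((prodBernoulli g).real (openConn g₂ b) - (prodBernoulli g).real (openConn x b)))) ≤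
      (prodBernoulli (fun f : Sym2 (Fin n) => if f = s(g₁, g₂) then 1 else g f)).real (openConn g₁ b) -
        (prodBernoulli (fun f : Sym2 (Fin n) => if f = s(g₁, g₂) then 1 else g f)).real (openConn x b) := by
  set μ := prodBernoulli g with hμ
  set gp : Sym2 (Fin n) → unitInterval := fun f => if f = s(g₁, g₂) then 1 else g f with hgp
  -- the same glued measure written from `g₂`'s side
  have hswap : (fun f : Sym2 (Fin n) => if f = s(g₂, g₁) then 1 else g f) = gp := by
    funext f; rw [hgp, Sym2.eq_swap]
  have e12 := UpsetExchange.real_openConn_pair_eq g h12 b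
  -- glued `g₁ ↔ b` and `g₂ ↔ b` coincide
  have hg12 : (prodBernoulli gp).real (openConn g₂ b) = (prodBernoulli gp).real (openConn g₁ b) := by
    rw [e12.1, e12.2]
  -- slack forms for both endpoints
  have S2 := pairGlue_anchor_le_add_posPart g h12 x b
  have S1 : (prodBernoulli gp).real (openConn x b) ≤ (prodBernoulli gp).real (openConn g₁ b) +
      max 0 (μ.real (openConn x b) - μ.real (openConn g₁ b)) := by
    have := pairGlue_anchor_le_add_posPart g h12.symm x b
    rw [hswap, hg12] at this
    exact this
  -- pair-gain monotonicity for the weaker endpoint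
  rcases le_total (μ.real (openConn g₁ b)) (μ.real (openConn g₂ b)) with hle | hle
  · have G := UpsetExchange.pairGlue_gain_le g h12 x b hle
    -- `h' ≥ h₁ = min`, `h' ≥ min 0 h₂ = min 0 max`
    have hmin : min (μ.real (openConn g₁ b) - μ.real (openConn x b)) (μ.real (openConn g₂ b) - μ.real (openConn x b)) =
        μ.real (openConn g₁ b) - μ.real (openConn x b) := min_eq_left (by linarith)
    have hmax : max (μ.real (openConn g₁ b) - μ.real (openConn x b)) (μ.real (openConn g₂ b) - μ.real (openConn x b)) =
        μ.real (openConn g₂ b) - μ.real (openConn x b) := max_eq_right (by linarith)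
    rw [hmin, hmax]
    refine max_le (by linarith) ?_
    rcases le_total 0 (μ.real (openConn x b) - μ.real (openConn g₂ b)) with h0 | h0
    · rw [max_eq_right h0] at S2
      have : min (0 : ℝ) (μ.real (openConn g₂ b) - μ.real (openConn x b)) = μ.real (openConn g₂ b) - μ.real (openConn x b) :=
        min_eq_right (by linarith)
      rw [this]; linarith
    · rw [max_eq_left h0] at S2
      have : min (0 : ℝ) (μ.real (openConn g₂ b) - μ.real (openConn x b)) = 0 := min_eq_left (by linarith)
      rw [this]; linarith
  · have G := UpsetExchange.pairGlue_gain_le g h12.symm x b hle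
    rw [hswap, hg12] at G
    have hmin : min (μ.real (openConn g₁ b) - μ.real (openConn x b)) (μ.real (openConn g₂ b) - μ.real (openConn x b)) =
        μ.real (openConn g₂ b) - μ.real (openConn x b) := min_eq_right (by linarith)
    have hmax : max (μ.real (openConn g₁ b) - μ.real (openConn x b)) (μ.real (openConn g₂ b) - μ.real (openConn x b)) =
        μ.real (openConn g₁ b) - μ.real (openConn x b) := max_eq_left (by linarith)
    rw [hmin, hmax]
    refine max_le (by linarith) ?_
    rcases le_total 0 (μ.real (openConn x b) - μ.real (openConn g₁ b)) with h0 | h0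
    · rw [max_eq_right h0] at S1
      have : min (0 : ℝ) (μ.real (openConn g₁ b) - μ.real (openConn x b)) = μ.real (openConn g₁ b) - μ.real (openConn x b) :=
        min_eq_right (by linarith)
      rw [this]; linarith
    · rw [max_eq_left h0] at S1
      have : min (0 : ℝ) (μ.real (openConn g₁ b) - μ.real (openConn x b)) = 0 := min_eq_left (by linarith)
      rw [this]; linarith

end BlockQ9

end

end Summit.CriticalPhenomena.PercolationContinuityZ3.Theorems
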